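import Summits.BirchSwinnertonDyer.BirchSwinnertonDyer.Theorems.CountingDoorF2AtThreeSchneiderOnDoorSubfamilyDenominator
import Literature.NumberTheory.EllipticCurves.DivisionValuesOmegaIdentityProofs
import HarnessLib

/-!
# BirchSwinnertonDyer / CountingDoorF2AtThree — crux I4loc `SchneiderOnDoorSubfamily`
# (stmt-BirchSwinnertonDyer-19682), line `valuation-class-at-three`: explicit division values of the
# marked points of `F₂` (the polynomials the digit certificate reduces modulo `9`)

Helper file (`--supports stmt-BirchSwinnertonDyer-19682 --as helper`; cell bsd-rank2, seat
cd-valclass-denom; PARTITION: none — r_an ≥ 2, summit axis S0), companion of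
`CountingDoorF2AtThreeSchneiderOnDoorSubfamilyDenominator` (the S2 package: `⟨nPᵢ, nPᵢ⟩ =
log₃ ψₙ(Pᵢ)² − 2 log₃ σ₃(−φₙψₙ/ωₙ)(Pᵢ)` for the marked points `P₁ = (a₂, 0)`, `P₂ = (a₂', 0)` of a type-∅
member `a = (a₁, a₂, a₂', a₃)` of `F₂`). Here the INTEGER division values entering that formula are made
explicit polynomials in the parameters (memo HOME/p2/PADIC-R2-G11.md §2.2/§2.4: `u_Q`, `t_Q` «are
determined by a mod 9»):

* the `b`-invariants of the integer model `a.curveInt = [a₁, 0, a₃, −(a₂² + a₂a₂' + a₂'²), a₂a₂'(a₂ + a₂')]`;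
* `Ψ₃` and `preΨ₄` of `a.curveInt` evaluated at an integer, in the `b`'s;
* `ψ₂(Pᵢ)` (from the companion file), `φ₂(Pᵢ) = aᵢψ₂(Pᵢ)² − Ψ₃(aᵢ)`, `ψ₃(Pᵢ) = Ψ₃(aᵢ)`,
  `2ω₂(Pᵢ) = preΨ₄(aᵢ) − a₁φ₂(Pᵢ)ψ₂(Pᵢ) − a₃ψ₂(Pᵢ)³` and in general
  `2ωₙ(Pᵢ)ψₙ(Pᵢ) = ψ₂ₙ(Pᵢ) − a₁φₙ(Pᵢ)ψₙ(Pᵢ)² − a₃ψₙ(Pᵢ)⁴` (tree `UnivEC.two_mul_ω_mul_ψ`);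
* on the door class `a ≡ (1, 0, 1, 0) (mod 3)` (`Ẽ : y² + xy = x³ − x` over `𝔽₃`, `P̃₁ = (0,0)` of order 2,
  `P̃₂ = (1,0)` of order 3): `3 ∣ ψ₂(P₁)` and `3 ∣ ψ₃(P₂)` — the multiples `2P₁`, `3P₂` lie in the formal
  group at `3` (eng-2's minimal multipliers; T12.md §2).

B1 honesty: polynomial identities and congruences only; nothing here mentions a Selmer group, an
`L`-value or an analytic rank.

References: Silverman *AEC* III.1 (b-invariants), Ex. 3.7 [SilvermanAEC2009]; Bhargava–Ho 2022 §1
[BhargavaHo2022].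
-/

-- the summit namespace `Summit.BirchSwinnertonDyer.BirchSwinnertonDyer.Theorems` repeats a component by design
-- (single-conjunct summit, CONVENTIONS §1), which the `dupNamespace` linter would flag on every declaration.
set_option linter.dupNamespace false

noncomputable section

open scoped Classical
open Polynomial WeierstrassCurve Literature.NumberTheory.EllipticCurves
  Literature.NumberTheory.EllipticCurves.BhargavaHo2022

namespace Summit.BirchSwinnertonDyer.BirchSwinnertonDyer.Theorems

variable (a : Params)

/-! ### The integer model and its `b`-invariants -/

/-- `a₁(E_a) = a₁`. [cite: BhargavaHo2022, §1 (definition of F₂)] -/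
@[simp] theorem params_curveInt_a₁ : a.curveInt.a₁ = a.a₁ := rfl
/-- `a₂(E_a) = 0` (the roots sum to zero). [cite: BhargavaHo2022, §1 (definition of F₂)] -/
@[simp] theorem params_curveInt_a₂ : a.curveInt.a₂ = 0 := rfl
/-- `a₃(E_a) = a₃`. [cite: BhargavaHo2022, §1 (definition of F₂)] -/
@[simp] theorem params_curveInt_a₃ : a.curveInt.a₃ = a.a₃ := rfl
/-- `a₄(E_a) = −(a₂² + a₂a₂' + a₂'²)`. [cite: BhargavaHo2022, §1 (definition of F₂)] -/
@[simp] theorem params_curveInt_a₄ : a.curveInt.a₄ = -(a.a₂ ^ 2 + a.a₂ * a.a₂' + a.a₂' ^ 2) := rfl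
/-- `a₆(E_a) = a₂a₂'(a₂ + a₂')`. [cite: BhargavaHo2022, §1 (definition of F₂)] -/
@[simp] theorem params_curveInt_a₆ : a.curveInt.a₆ = a.a₂ * a.a₂' * (a.a₂ + a.a₂') := rfl

/-- `b₂ = a₁²`. [cite: SilvermanAEC2009, III.1 (b-invariants)] -/
theorem params_curveInt_b₂ : a.curveInt.b₂ = a.a₁ ^ 2 := by
  simp [WeierstrassCurve.b₂]
/-- `b₄ = a₁a₃ − 2(a₂² + a₂a₂' + a₂'²)`. [cite: SilvermanAEC2009, III.1 (b-invariants)] -/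
theorem params_curveInt_b₄ : a.curveInt.b₄ = a.a₁ * a.a₃ - 2 * (a.a₂ ^ 2 + a.a₂ * a.a₂' + a.a₂' ^ 2) := by
  simp [WeierstrassCurve.b₄]; ring
/-- `b₆ = a₃² + 4a₂a₂'(a₂ + a₂')`. [cite: SilvermanAEC2009, III.1 (b-invariants)] -/
theorem params_curveInt_b₆ : a.curveInt.b₆ = a.a₃ ^ 2 + 4 * (a.a₂ * a.a₂' * (a.a₂ + a.a₂')) := by
  simp [WeierstrassCurve.b₆]
/-- `b₈ = a₁²a₂a₂'(a₂+a₂') + a₁a₃(a₂²+a₂a₂'+a₂'²) − (a₂²+a₂a₂'+a₂'²)²`. [cite: SilvermanAEC2009, III.1 (b-invariants)] -/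
theorem params_curveInt_b₈ : a.curveInt.b₈ = a.a₁ ^ 2 * (a.a₂ * a.a₂' * (a.a₂ + a.a₂')) +
    a.a₁ * a.a₃ * (a.a₂ ^ 2 + a.a₂ * a.a₂' + a.a₂' ^ 2) - (a.a₂ ^ 2 + a.a₂ * a.a₂' + a.a₂' ^ 2) ^ 2 := by
  simp [WeierstrassCurve.b₈]; ring

/-- `Ψ₃(x) = 3x⁴ + b₂x³ + 3b₄x² + 3b₆x + b₈` evaluated at an integer. [cite: SilvermanAEC2009, Exercise 3.7(d)] -/
theorem params_Ψ₃_eval (x : ℤ) : a.curveInt.Ψ₃.eval x =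
    3 * x ^ 4 + a.curveInt.b₂ * x ^ 3 + 3 * a.curveInt.b₄ * x ^ 2 + 3 * a.curveInt.b₆ * x + a.curveInt.b₈ := by
  simp [WeierstrassCurve.Ψ₃]

/-- `preΨ₄(x) = 2x⁶ + b₂x⁵ + 5b₄x⁴ + 10b₆x³ + 10b₈x² + (b₂b₈ − b₄b₆)x + (b₄b₈ − b₆²)` evaluated at an
integer. [cite: SilvermanAEC2009, Exercise 3.7(d)] -/
theorem params_preΨ₄_eval (x : ℤ) : a.curveInt.preΨ₄.eval x =
    2 * x ^ 6 + a.curveInt.b₂ * x ^ 5 + 5 * a.curveInt.b₄ * x ^ 4 + 10 * a.curveInt.b₆ * x ^ 3 +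
      10 * a.curveInt.b₈ * x ^ 2 + (a.curveInt.b₂ * a.curveInt.b₈ - a.curveInt.b₄ * a.curveInt.b₆) * x +
        (a.curveInt.b₄ * a.curveInt.b₈ - a.curveInt.b₆ ^ 2) := by
  simp [WeierstrassCurve.preΨ₄]

/-! ### The marked points on the integer model -/

/-- `P₁ = (a₂, 0)` satisfies the INTEGER equation of `a.curveInt`. [cite: BhargavaHo2022, §1 (F₂: marked point (a₂, 0))] -/
theorem params_equation_curveInt_markedPoint₁ : a.curveInt.toAffine.Equation a.a₂ 0 := by
  rw [WeierstrassCurve.Affine.equation_iff]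
  simp; ring

/-- `P₂ = (a₂', 0)` satisfies the integer equation of `a.curveInt`. [cite: BhargavaHo2022, §1 (F₂: marked point (a₂', 0))] -/
theorem params_equation_curveInt_markedPoint₂ : a.curveInt.toAffine.Equation a.a₂' 0 := by
  rw [WeierstrassCurve.Affine.equation_iff]
  simp; ring

/-- **`φ₂(P₁) = a₂ψ₂(P₁)² − Ψ₃(a₂) = a₂(a₁a₂ + a₃)² − Ψ₃(a₂)`.** [cite: SilvermanAEC2009, Exercise 3.7(d)] -/
theorem params_φ_two_markedPoint₁ :
    (a.curveInt.φ 2).evalEval a.a₂ 0 = a.a₂ * (a.a₁ * a.a₂ + a.a₃) ^ 2 - a.curveInt.Ψ₃.eval a.a₂ := by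
  rw [WeierstrassCurve.φ_two, evalEval_sub, evalEval_mul, evalEval_C, evalEval_pow, eval_X,
    ← WeierstrassCurve.ψ_two, params_ψ_two_markedPoint₁, evalEval_C]

/-- **`φ₂(P₂) = a₂'(a₁a₂' + a₃)² − Ψ₃(a₂')`.** [cite: SilvermanAEC2009, Exercise 3.7(d)] -/
theorem params_φ_two_markedPoint₂ :
    (a.curveInt.φ 2).evalEval a.a₂' 0 = a.a₂' * (a.a₁ * a.a₂' + a.a₃) ^ 2 - a.curveInt.Ψ₃.eval a.a₂' := by
  rw [WeierstrassCurve.φ_two, evalEval_sub, evalEval_mul, evalEval_C, evalEval_pow, eval_X,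
    ← WeierstrassCurve.ψ_two, params_ψ_two_markedPoint₂, evalEval_C]

/-- **`2ωₙ(P₁)ψₙ(P₁) = ψ₂ₙ(P₁) − a₁φₙ(P₁)ψₙ(P₁)² − a₃ψₙ(P₁)⁴`** (ωₙ(P₁) = `UnivEC.ev a.curveInt a₂ 0 (UnivEC.ω n)`,
the integer entering `t_Q = −φₙψₙ/ωₙ`): determines `ωₙ(P₁)` from the `ψ`'s whenever `ψₙ(P₁) ≠ 0`.
[cite: SilvermanAEC2009, Exercise 3.7(d)] -/
theorem params_two_mul_ω_mul_ψ_markedPoint₁ (n : ℤ) :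
    2 * UnivEC.ev a.curveInt a.a₂ 0 (UnivEC.ω n) * (a.curveInt.ψ n).evalEval a.a₂ 0 =
      (a.curveInt.ψ (2 * n)).evalEval a.a₂ 0 -
        a.a₁ * (a.curveInt.φ n).evalEval a.a₂ 0 * (a.curveInt.ψ n).evalEval a.a₂ 0 ^ 2 -
          a.a₃ * (a.curveInt.ψ n).evalEval a.a₂ 0 ^ 4 :=
  a.curveInt.two_mul_ev_ω_mul_evalEval_ψ (params_equation_curveInt_markedPoint₁ a) n

/-- **`2ωₙ(P₂)ψₙ(P₂) = ψ₂ₙ(P₂) − a₁φₙ(P₂)ψₙ(P₂)² − a₃ψₙ(P₂)⁴`.** [cite: SilvermanAEC2009, Exercise 3.7(d)] -/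
theorem params_two_mul_ω_mul_ψ_markedPoint₂ (n : ℤ) :
    2 * UnivEC.ev a.curveInt a.a₂' 0 (UnivEC.ω n) * (a.curveInt.ψ n).evalEval a.a₂' 0 =
      (a.curveInt.ψ (2 * n)).evalEval a.a₂' 0 -
        a.a₁ * (a.curveInt.φ n).evalEval a.a₂' 0 * (a.curveInt.ψ n).evalEval a.a₂' 0 ^ 2 -
          a.a₃ * (a.curveInt.ψ n).evalEval a.a₂' 0 ^ 4 :=
  a.curveInt.two_mul_ev_ω_mul_evalEval_ψ (params_equation_curveInt_markedPoint₂ a) n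

/-- **`2ω₂(P₁) = preΨ₄(a₂) − a₁φ₂(P₁)(a₁a₂ + a₃) − a₃(a₁a₂ + a₃)³`** (the integer `ω₂(P₁)` of
`2P₁ = (φ₂/ψ₂², ω₂/ψ₂³)`, explicitly). [cite: SilvermanAEC2009, Exercise 3.7(d)] -/
theorem params_two_mul_ω_two_markedPoint₁ :
    2 * UnivEC.ev a.curveInt a.a₂ 0 (UnivEC.ω 2) =
      a.curveInt.preΨ₄.eval a.a₂ - a.a₁ * (a.curveInt.φ 2).evalEval a.a₂ 0 * (a.a₁ * a.a₂ + a.a₃) -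
        a.a₃ * (a.a₁ * a.a₂ + a.a₃) ^ 3 := by
  rw [a.curveInt.two_mul_ev_ω_two (params_equation_curveInt_markedPoint₁ a), params_ψ_two_markedPoint₁]
  rfl

/-- **`2ω₂(P₂) = preΨ₄(a₂') − a₁φ₂(P₂)(a₁a₂' + a₃) − a₃(a₁a₂' + a₃)³`.** [cite: SilvermanAEC2009, Exercise 3.7(d)] -/
theorem params_two_mul_ω_two_markedPoint₂ :
    2 * UnivEC.ev a.curveInt a.a₂' 0 (UnivEC.ω 2) =
      a.curveInt.preΨ₄.eval a.a₂' - a.a₁ * (a.curveInt.φ 2).evalEval a.a₂' 0 * (a.a₁ * a.a₂' + a.a₃) -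
        a.a₃ * (a.a₁ * a.a₂' + a.a₃) ^ 3 := by
  rw [a.curveInt.two_mul_ev_ω_two (params_equation_curveInt_markedPoint₂ a), params_ψ_two_markedPoint₂]
  rfl

/-! ### Levels on the door class `a ≡ (1, 0, 1, 0) (mod 3)` -/

/-- **`3 ∣ ψ₂(P₁)` as soon as `3 ∣ a₂` and `3 ∣ a₃`** (door class: `P̃₁ = (0, 0)` is the `2`-torsion point
of `y² + xy = x³ − x` over `𝔽₃`, so `2P₁ ∈ Ê(3ℤ₃)`). [cite: SilvermanAEC2009, Exercise 3.7(d)] -/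
theorem params_three_dvd_ψ_two_markedPoint₁ (h₂ : (3 : ℤ) ∣ a.a₂) (h₃ : (3 : ℤ) ∣ a.a₃) :
    (3 : ℤ) ∣ (a.curveInt.ψ 2).evalEval a.a₂ 0 := by
  rw [params_ψ_two_markedPoint₁]
  exact dvd_add (dvd_mul_of_dvd_right h₂ _) h₃

/-- **`3 ∣ ψ₃(P₂)` on the door class `a ≡ (1, 0, 1, 0) (mod 3)`** (`P̃₂ = (1, 0)` has order `3` on
`y² + xy = x³ − x` over `𝔽₃`, so `3P₂ ∈ Ê(3ℤ₃)`); stated with the residues in `ZMod 3`.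
[cite: SilvermanAEC2009, Exercise 3.7(d)] -/
theorem params_three_dvd_ψ_three_markedPoint₂ (h₁ : (a.a₁ : ZMod 3) = 1) (h₂ : (a.a₂ : ZMod 3) = 0)
    (h₂' : (a.a₂' : ZMod 3) = 1) (h₃ : (a.a₃ : ZMod 3) = 0) :
    (3 : ℤ) ∣ (a.curveInt.ψ 3).evalEval a.a₂' 0 := by
  have e : (a.curveInt.ψ 3).evalEval a.a₂' 0 = 3 * a.a₂' ^ 4 + a.curveInt.b₂ * a.a₂' ^ 3 +
      3 * a.curveInt.b₄ * a.a₂' ^ 2 + 3 * a.curveInt.b₆ * a.a₂' + a.curveInt.b₈ := by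
    rw [params_ψ_three_eval, params_Ψ₃_eval]
  rw [e, params_curveInt_b₂, params_curveInt_b₄, params_curveInt_b₆, params_curveInt_b₈]
  show ((3 : ℕ) : ℤ) ∣ _
  rw [← ZMod.intCast_zmod_eq_zero_iff_dvd]
  push_cast
  rw [h₁, h₂, h₂', h₃]
  decide

end Summit.BirchSwinnertonDyer.BirchSwinnertonDyer.Theorems

end
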